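import Summits.CriticalPhenomena.PercolationContinuityZ3.Theorems.Transplant.FKThreeApexT3EnvelopeFibre
import Summits.CriticalPhenomena.PercolationContinuityZ3.Theorems.Transplant.FKThreeApexCap
import Summits.CriticalPhenomena.PercolationContinuityZ3.Theorems.Transplant.FKThreeApexPhiNat
import HarnessLib

/-!
# The three-apex monoid: the TOP of the `Z₁`-fibre — `EnvelopeA q` for every `q` from two polynomial lemmas

Helper file (`--supports stmt-CriticalPhenomena-4575`), FK sub-lane `prim-bschramm-fk-3` (gen 17); builds on p205010 (kernel theorem,
internal audit signed; external expert review pending).  No sorries; standard axioms.  Memo `bschramm/prim-bschramm-fk-3/T3-FIBRE.md`.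

The open core of type T3 (memo T3-ENVELOPE §10–13) is `EnvelopeA q` for `0 < q < 1/4`: non-negativity of the frontier form
`vForm q θ θ' Z` on the monoid.  File `…T3EnvelopeFibre` showed that `vForm` is AFFINE along the `Z₁`-fibre and non-negative at its
lower end, which settles the regime of non-negative slope.  In the regime of NEGATIVE slope the value at the actual point is bounded
below by the value at any valid UPPER bound for `Z₁`; two such bounds are polynomial (affine in the total mass `v̂`):

* the cap `capA q Z ≥ 0` (`InK.capA_nonneg`): `v̂ ≤ c₀/û³`, giving `û³·V = CL_cap + (−V₁)·capA` (`cap_identity`);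
* the HARMONIC-WEIGHT instance `Φ_a(Z_ac, Z_ab) ≥ 0` of `(U_a)` (`InK.uCond` at the weights `(ŷ−û, x̂−û)`, the optimal weights to
  leading order at the identity corner): `(−φ₁)·V = CL_g + (−V₁)·Φ_a(Z_ac,Z_ab)` (`harm_identity`).

Which bound is lower is decided by the sign of the `θ,θ'`-free polynomial `κ_A` (`kappaSw`).  Hence (`vForm_nonneg_core`) the whole
statement reduces to two explicit polynomial inequalities in seven real variables `(û, Z_ab, Z_ac, Z_bc − Z_ac, q, θ, θ')` on an orthant:
`FibreTopHarm q` (L2: `κ_A ≤ 0 ⟹ CL_g ≥ 0`) and `FibreTopCap q` (L3: `κ_A ≥ 0 ⟹ CL_cap ≥ 0`), both stated here as predicates of `q`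
and verified numerically (> 10⁶ float and > 8·10⁴ exact rational sample points, 0 failures; memo §4).  Their common tangent cone at the
identity corner is the corner lemma (CL) of memo T3-ENVELOPE §13, which has the exact SOS certificate recorded in the docstring of
`FibreTopHarm`.  Main results:

* `vForm_nonneg_of_outer_of_fibreTop`: L2 ∧ L3 at `q` ⟹ `vForm q θ θ' Z ≥ 0` for all `θ, θ' ≥ 0` and every `Z` with `Z.Nonneg`,
  `capA q Z ≥ 0`, `(U_a)`, `(U_b)` — in fact only the two harmonic instances `Φ_a(Z_ac,Z_ab)`, `Φ_b(Z_bc,Z_ab)` are used, and neither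
  `capB` nor `capC`;
* `envelopeA_of_fibreTop`: L2 ∧ L3 at `q` ⟹ `EnvelopeA q` (hence, with `…NegCorrT3OfEnvelope`, type T3 and negative correlation of
  every pair of edges of every weighted `K_{1,1,1,n}` at that `q`).

Deliberately NOT here: proofs of L2/L3 (certificate search in progress, memo §5–6). [folklore]
-/

noncomputable section

namespace Summit.CriticalPhenomena.PercolationContinuityZ3.Theorems

namespace FK

namespace ThreeApex

/-! ### Fibre coordinates -/

/-- The environment with fibre masses `Z₀ = u`, `Z_ab = a`, `Z_ac = b`, `Z_bc = b + d` and TOTAL mass `v` (so `Z₁ = v − (u + a + 2b + d)`).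
For `v` below `u + a + 2b + d` this is a formal point (negative `Z₁`), used only to read off the affine structure in `v`. [folklore] -/
def fibreZ (u a b d v : ℝ) : V5 := ⟨u, a, b, b + d, v - (u + a + 2 * b + d)⟩

/-- `(fibreZ u a b d v).total = v`. [folklore] -/
theorem fibreZ_total (u a b d v : ℝ) : (fibreZ u a b d v).total = v := by
  simp only [fibreZ, V5.total]; ring

/-- The `v`-free part of the frontier form along the fibre: `V₀ := V(θ,θ'; fibreZ u a b d 0)`. [folklore] -/
def vZero (u a b d q t s : ℝ) : ℝ := vForm q t s (fibreZ u a b d 0)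

/-- The `v`-slope of the frontier form along the fibre (`= vSlope`, which depends on the hat coordinates only). [folklore] -/
def vOne (u a b d q t s : ℝ) : ℝ := vSlope q t s (fibreZ u a b d 0)

/-- **Affine structure**: `V(fibreZ u a b d v) = V₀ + v · V₁`. [folklore] -/
theorem vForm_fibreZ (u a b d q t s v : ℝ) :
    vForm q t s (fibreZ u a b d v) = vZero u a b d q t s + v * vOne u a b d q t s := by
  simp only [vZero, vOne, vForm, envForm, vSlope, fibreZ, eAA, eBB, eCC, nAB, nAC, nBC, pAB, pAC, pBC, pTop, hx, hy, hz,
    V5.total]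
  ring

/-- The slope at a general point of the fibre is `vOne`. [folklore] -/
theorem vSlope_fibreZ (u a b d q t s v : ℝ) : vSlope q t s (fibreZ u a b d v) = vOne u a b d q t s := by
  simp only [vOne, vSlope, fibreZ, hx, hy, hz]

/-- The HARMONIC-WEIGHT instance of `(U_a)`: `Φ_a(w₁ = Z_ac, w₂ = Z_ab)` — the weights `(ŷ − û, x̂ − û)`, which are the optimal
`U_a`-weights to leading order at the identity corner. Its `v`-free part `φ₀`. [folklore] -/
def phiH0 (u a b d q : ℝ) : ℝ := uForm q b a (fibreZ u a b d 0)

/-- The `v`-slope `φ₁` of the harmonic-weight instance. [folklore] -/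
def phiH1 (u a b d q : ℝ) : ℝ := uForm q b a (fibreZ u a b d 1) - phiH0 u a b d q

/-- **Affine structure of the harmonic instance**: `Φ_a(b,a)(fibreZ u a b d v) = φ₀ + v · φ₁`. [folklore] -/
theorem uForm_harm_fibreZ (u a b d q v : ℝ) :
    uForm q b a (fibreZ u a b d v) = phiH0 u a b d q + v * phiH1 u a b d q := by
  simp only [phiH0, phiH1, uForm, masterN, massA, swapBC, fibreZ]
  ring

/-- The `v`-free part of the cap form `capA`: `c₀ = x̂ŷẑ((1−q)û + q x̂)`. [folklore] -/
def capA0 (u a b d q : ℝ) : ℝ := (u + a) * (u + b) * (u + b + d) * ((1 - q) * u + q * (u + a))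

/-- `capA(fibreZ u a b d v) = c₀ − v u³`. [folklore] -/
theorem capA_fibreZ (u a b d q v : ℝ) : capA q (fibreZ u a b d v) = capA0 u a b d q - v * u ^ 3 := by
  simp only [capA, capA0, fibreZ, hx, hy, hz, V5.total]; ring

/-! ### The two `v`-free polynomials of the fibre top and the switch `κ_A` -/

/-- `CL_g := V₁ φ₀ − V₀ φ₁` — equals `(−φ₁) · V` evaluated at the harmonic `U_a`-bound `v_h = φ₀/(−φ₁)` (the global analogue of the
corner lemma (CL) of memo T3-ENVELOPE §13). [folklore] -/
def clHarm (u a b d q t s : ℝ) : ℝ :=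
  vOne u a b d q t s * phiH0 u a b d q - vZero u a b d q t s * phiH1 u a b d q

/-- `CL_cap := u³ V₀ + V₁ c₀` — equals `u³ · V` evaluated at the `capA`-bound `v_cap = c₀/u³`. [folklore] -/
def clCap (u a b d q t s : ℝ) : ℝ :=
  u ^ 3 * vZero u a b d q t s + vOne u a b d q t s * capA0 u a b d q

/-- The switch `κ_A := φ₀ u³ + φ₁ c₀` — equals `u³ ·` (harmonic instance evaluated at the cap point); `κ_A ≤ 0` iff the harmonic
`U_a`-bound lies below the `capA`-bound (it is `θ, θ'`-free). [folklore] -/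
def kappaSw (u a b d q : ℝ) : ℝ := phiH0 u a b d q * u ^ 3 + phiH1 u a b d q * capA0 u a b d q

/-- **Identity at the harmonic bound**: `(−φ₁) · V(fibreZ v) = CL_g + (−V₁) · Φ_a(b,a)(fibreZ v)`. [folklore] -/
theorem harm_identity (u a b d q t s v : ℝ) :
    (-phiH1 u a b d q) * vForm q t s (fibreZ u a b d v) =
      clHarm u a b d q t s + (-vOne u a b d q t s) * uForm q b a (fibreZ u a b d v) := by
  rw [vForm_fibreZ, uForm_harm_fibreZ, clHarm]; ring

/-- **Identity at the cap bound**: `u³ · V(fibreZ v) = CL_cap + (−V₁) · capA(fibreZ v)`. [folklore] -/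
theorem cap_identity (u a b d q t s v : ℝ) :
    u ^ 3 * vForm q t s (fibreZ u a b d v) = clCap u a b d q t s + (-vOne u a b d q t s) * capA q (fibreZ u a b d v) := by
  rw [vForm_fibreZ, capA_fibreZ, clCap]; ring

/-! ### `φ₀ ≥ 0` (so that `κ_A < 0` forces `φ₁ < 0`) and `u = 0 ⇒ V₁ ≥ 0` -/

/-- `φ₀` explicitly: a polynomial with non-negative coefficients in `u, a, b, d, q, 1−q`. [folklore] -/
theorem phiH0_eq (u a b d q : ℝ) : phiH0 u a b d q =
    (1 - q) * (b ^ 2 * (u + b) * (u + b + d) + a ^ 2 * (u + a) * (u + b + d)) + (2 - q) * (a * b * ((u + b + d) * (u + a + b))) := by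
  simp only [phiH0, uForm, masterN, massA, swapBC, fibreZ]; ring

/-- `φ₀ ≥ 0` on the orthant (`q ≤ 1`). [folklore] -/
theorem phiH0_nonneg {u a b d q : ℝ} (hu : 0 ≤ u) (ha : 0 ≤ a) (hb : 0 ≤ b) (hd : 0 ≤ d) (hq1 : q ≤ 1) :
    0 ≤ phiH0 u a b d q := by
  rw [phiH0_eq]
  have h1 : 0 ≤ 1 - q := by linarith
  have h2 : 0 ≤ 2 - q := by linarith
  positivity

/-- `c₀ > 0` when `u > 0` (`0 ≤ q ≤ 1`). [folklore] -/
theorem capA0_pos {u a b d q : ℝ} (hu : 0 < u) (ha : 0 ≤ a) (hb : 0 ≤ b) (hd : 0 ≤ d) (hq0 : 0 ≤ q) :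
    0 < capA0 u a b d q := by
  unfold capA0
  have h1 : 0 < (1 - q) * u + q * (u + a) := by nlinarith
  positivity

/-- If `κ_A < 0` then `φ₁ < 0` (since `φ₀, c₀ ≥ 0`). [folklore] -/
theorem phiH1_neg_of_kappaSw_neg {u a b d q : ℝ} (hu : 0 < u) (ha : 0 ≤ a) (hb : 0 ≤ b) (hd : 0 ≤ d) (hq0 : 0 ≤ q) (hq1 : q ≤ 1)
    (hk : kappaSw u a b d q < 0) : phiH1 u a b d q < 0 := by
  have h0 := phiH0_nonneg hu.le ha hb hd hq1
  have hc := capA0_pos hu ha hb hd hq0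
  rcases lt_or_ge (phiH1 u a b d q) 0 with h | h
  · exact h
  · exfalso
    have : 0 ≤ kappaSw u a b d q := by unfold kappaSw; positivity
    linarith

/-- At `u = 0` the slope is non-negative: `V₁(0,a,b,d) ≥ 0` (all its coefficients are then `≥ 0`). [folklore] -/
theorem vOne_nonneg_of_u_zero {a b d q t s : ℝ} (ha : 0 ≤ a) (hb : 0 ≤ b) (hd : 0 ≤ d) (hq0 : 0 ≤ q)
    (ht : 0 ≤ t) (hs : 0 ≤ s) : 0 ≤ vOne 0 a b d q t s := by
  have e : vOne 0 a b d q t s = a + s * (q * (a + b + d)) + s ^ 2 * (b + d) + t * (q * (a + b))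
      + t * s * (2 * q * (2 * b + d) + q ^ 2 * (a + 2 * b + d)) + t * s ^ 2 * (2 * b + 2 * d + q * (2 * b + d))
      + t ^ 2 * b + t ^ 2 * s * (2 * b + q * (2 * b + d)) + t ^ 2 * s ^ 2 * (2 * b + d) := by
    simp only [vOne, vSlope, fibreZ, hx, hy, hz]; ring
  rw [e]; positivity

/-! ### The two polynomial lemmas of the fibre top (stated; proved in companion files) -/

/-- **Lemma L2 (harmonic piece)** at cluster weight `q`, as a statement: on the orthant `u > 0, a, b, d, θ, θ' ≥ 0`, in the negative-slope regime,
`κ_A ≤ 0 ⟹ CL_g ≥ 0`.  Numerically verified (0 failures in > 10⁶ random and monoid-derived points, incl. exact rational checks); its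
tangent cone at the identity corner is the corner lemma (CL), which has the explicit SOS certificate
`(a+b+k)·CL = ((a+b+k)(a−θb) − θ'[(a+b)(c+θ(b+c)) + k(aθ+b)])² + θ'·H₀ + θ'²·H₁`, `H₀, H₁ ∈ ℕ[a,b,c−b,k,θ]`. [folklore] -/
def FibreTopHarm (q : ℝ) : Prop :=
  ∀ u a b d t s : ℝ, 0 < u → 0 ≤ a → 0 ≤ b → 0 ≤ d → 0 ≤ t → 0 ≤ s →
    vOne u a b d q t s < 0 → kappaSw u a b d q ≤ 0 → 0 ≤ clHarm u a b d q t s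

/-- **Lemma L3 (cap piece)** at cluster weight `q`, as a statement: same domain, `κ_A ≥ 0 ⟹ CL_cap ≥ 0`.  Numerically verified as for L2. [folklore] -/
def FibreTopCap (q : ℝ) : Prop :=
  ∀ u a b d t s : ℝ, 0 < u → 0 ≤ a → 0 ≤ b → 0 ≤ d → 0 ≤ t → 0 ≤ s →
    vOne u a b d q t s < 0 → 0 ≤ kappaSw u a b d q → 0 ≤ clCap u a b d q t s

/-! ### Assembly: the envelope statement (A) for every `q` from the two fibre-top lemmas -/

/-- Every environment is a point of its own fibre: `Z = fibreZ Z₀ Z_ab Z_ac (Z_bc − Z_ac) Z.total`. [folklore] -/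
theorem fibreZ_self (Z : V5) : fibreZ Z.z0 Z.zab Z.zac (Z.zbc - Z.zac) Z.total = Z := by
  ext <;> simp only [fibreZ, V5.total] <;> ring

/-- **Core** (case `Z_ac ≤ Z_bc`): from `Z.Nonneg`, `capA ≥ 0` and the single harmonic instance `Φ_a(Z_ac, Z_ab) ≥ 0`,
the two fibre-top lemmas give `vForm ≥ 0`. [folklore] -/
theorem vForm_nonneg_core {q : ℝ} (hL2 : FibreTopHarm q) (hL3 : FibreTopCap q) {t s : ℝ} (hq0 : 0 < q) (hq1 : q ≤ 1) (ht : 0 ≤ t)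
    (hs : 0 ≤ s) {Z : V5} (hZ : Z.Nonneg) (hle : Z.zac ≤ Z.zbc) (hcap : 0 ≤ capA q Z) (hU : 0 ≤ uForm q Z.zac Z.zab Z) :
    0 ≤ vForm q t s Z := by
  rcases le_or_gt 0 (vSlope q t s Z) with hsl | hsl
  · exact vForm_nonneg_of_vSlope_nonneg hq0.le hq1 ht hs hZ hle hsl
  -- negative slope: the fibre top
  set u := Z.z0 with hu_def
  set a := Z.zab with ha_def
  set b := Z.zac with hb_def
  set d := Z.zbc - Z.zac with hd_def
  set v := Z.total with hv_def
  have hd : 0 ≤ d := sub_nonneg.2 hle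
  have eZ : Z = fibreZ u a b d v := (fibreZ_self Z).symm
  have hsl' : vOne u a b d q t s < 0 := by rw [← vSlope_fibreZ u a b d q t s v, ← eZ]; exact hsl
  have hu : 0 < u := by
    rcases eq_or_lt_of_le hZ.h0 with h | h
    · exfalso
      have h0 : u = 0 := h.symm
      have := vOne_nonneg_of_u_zero (q := q) (t := t) (s := s) hZ.hab hZ.hac hd hq0.le ht hs
      rw [← h0] at this
      linarith
    · exact h
  rcases le_or_gt 0 (kappaSw u a b d q) with hk | hk
  · -- cap piece
    have h3 := hL3 u a b d t s hu hZ.hab hZ.hac hd ht hs hsl' hk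
    have hid := cap_identity u a b d q t s v
    rw [← eZ] at hid
    have h4 : 0 ≤ u ^ 3 * vForm q t s Z := by
      rw [hid]; exact add_nonneg h3 (mul_nonneg (by linarith) hcap)
    exact le_of_mul_le_mul_left (by rw [mul_zero]; exact h4) (pow_pos hu 3)
  · -- harmonic piece
    have hφ := phiH1_neg_of_kappaSw_neg hu hZ.hab hZ.hac hd hq0.le hq1 hk
    have h2 := hL2 u a b d t s hu hZ.hab hZ.hac hd ht hs hsl' hk.le
    have hid := harm_identity u a b d q t s v
    rw [← eZ] at hid
    have h4 : 0 ≤ (-phiH1 u a b d q) * vForm q t s Z := by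
      rw [hid]; exact add_nonneg h2 (mul_nonneg (by linarith) hU)
    exact le_of_mul_le_mul_left (by rw [mul_zero]; exact h4) (by linarith)

/-- **Both orderings** (the case `Z_bc ≤ Z_ac` is the `a ↔ b` mirror: `capA` is symmetric, the harmonic `U_a`-instance becomes the
harmonic `U_b`-instance `Φ_b(Z_bc, Z_ab)`). [folklore] -/
theorem vForm_nonneg_of_fibreTop {q : ℝ} (hL2 : FibreTopHarm q) (hL3 : FibreTopCap q) {t s : ℝ} (hq0 : 0 < q) (hq1 : q ≤ 1)
    (ht : 0 ≤ t) (hs : 0 ≤ s) {Z : V5} (hZ : Z.Nonneg) (hcap : 0 ≤ capA q Z) (hUa : 0 ≤ uForm q Z.zac Z.zab Z)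
    (hUb : 0 ≤ phiB q Z.zbc Z.zab Z) : 0 ≤ vForm q t s Z := by
  rcases le_total Z.zac Z.zbc with hle | hle
  · exact vForm_nonneg_core hL2 hL3 hq0 hq1 ht hs hZ hle hcap hUa
  · rw [vForm_swapAB]
    have hcap' : 0 ≤ capA q (swapAB Z) := by
      have e : capA q (swapAB Z) = capA q Z := by simp only [capA, swapAB, hx, hy, hz, V5.total]; ring
      rw [e]; exact hcap
    have hU' : 0 ≤ uForm q (swapAB Z).zac (swapAB Z).zab (swapAB Z) := by
      rw [← phiB_eq_uForm_swapAB]; exact hUb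
    exact vForm_nonneg_core hL2 hL3 hq0 hq1 hs ht ⟨hZ.h0, hZ.hab, hZ.hbc, hZ.hac, hZ.h1⟩ hle hcap' hU'

/-- **The open goal of memo T3-ENVELOPE §13, reduced**: the two fibre-top lemmas imply `vForm ≥ 0` on the whole outer set
(`Z.Nonneg`, the cap `capA`, `(U_a)` and `(U_b)` — only ONE instance of each is used, at the harmonic weights). [folklore] -/
theorem vForm_nonneg_of_outer_of_fibreTop {q : ℝ} (hL2 : FibreTopHarm q) (hL3 : FibreTopCap q) {θ θ' : ℝ} (hq0 : 0 < q) (hq1 : q ≤ 1)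
    (hθ : 0 ≤ θ) (hθ' : 0 ≤ θ') {Z : V5} (hZ : Z.Nonneg) (hcapA : 0 ≤ capA q Z)
    (hUa : ∀ w₁ w₂ : ℝ, 0 ≤ w₁ → 0 ≤ w₂ → 0 ≤ uForm q w₁ w₂ Z) (hUb : ∀ w₁ w₂ : ℝ, 0 ≤ w₁ → 0 ≤ w₂ → 0 ≤ phiB q w₁ w₂ Z) :
    0 ≤ vForm q θ θ' Z :=
  vForm_nonneg_of_fibreTop hL2 hL3 hq0 hq1 hθ hθ' hZ hcapA (hUa _ _ hZ.hac hZ.hab) (hUb _ _ hZ.hbc hZ.hab)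

/-- **`EnvelopeA q` for every `0 < q ≤ 1` from the two fibre-top lemmas.** [folklore] -/
theorem envelopeA_of_fibreTop {q : ℝ} (hL2 : FibreTopHarm q) (hL3 : FibreTopCap q) (hq0 : 0 < q) (hq1 : q ≤ 1) : EnvelopeA q := by
  intro θ θ' hθ hθ' Z hZ
  exact vForm_nonneg_of_outer_of_fibreTop hL2 hL3 hq0 hq1 hθ hθ' (hZ.nonneg hq0.le) (hZ.capA_nonneg hq0.le hq1)
    (hZ.uCond hq0 hq1) (fun w₁ w₂ h₁ h₂ => hZ.phiB_nonneg hq0 hq1 h₁ h₂)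

end ThreeApex

end FK

end Summit.CriticalPhenomena.PercolationContinuityZ3.Theorems
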